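/-
Copyright (c) 2026 the pub-hodgecm-mathlib formalisation cell (harness21).  Prover seat hodgecm-mathlib-K2E3-p17 (g9), R90-S1: socket S1#7 AS TYPED from road α′'s ★ box theorem
(`R90S1SplitInducedIrreducibleBox`, R90-C10-p01) by the variable-labelling `subst` transport.  2026-09-04.
-/
import Summits.HodgeConjecture.HodgeConjecture.Theorems.R90S1SplitInducedIrreducibleBox        -- ★ road α′ `R90.S1.isIrreducible_parabolicIndGL_box_of_isUnitarizable`
import Summits.HodgeConjecture.HodgeConjecture.Theorems.K2E3GL3ExponentRules                  -- ★ `exists_blockEquiv_twoOne`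
import Summits.HodgeConjecture.HodgeConjecture.Theorems.K2E3GL3MaximalParabolicRelabel         -- ★ `lastBlockLabel_three`
import Literature.RepresentationTheory.IrreducibleTwistTransport                               -- ★ `isIrreducible_comp_iff_of_surjective`
import Literature.NumberTheory.Automorphic.ParabolicInductionAdmissibleProofs                  -- ★ `continuous_reindexGL`
import Literature.NumberTheory.Automorphic.ParabolicGLReindex                                  -- ★ `IsSmooth.comp_of_continuous`
import HarnessLib

/-!
# R90-S1 (Rogawski §12.2, split places) — SOCKET S1#7 AS TYPED: `n-Ind_{P_{(2,1)}}^{GL₃(F)}(σ ⊠ χ′)` is irreducible for `σ` irreducible smooth unitarizable, `χ′` unitary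

Cell `hodgecm-mathlib`, R90-S1; THEOREMS ONLY; count-neutral (`--supports stmt-HodgeConjecture-24833 --as helper`); rule R-S1-1 (no `Lines` import).
Road α′ (R90-C10-p01) proved the statement in ★ E2-I's «box» currency — `σ₂` on `GL₂(F)` read through `(reindexGL e)⁻¹`, labelling `![false,false,true]`
(★ `R90.S1.isIrreducible_parabolicIndGL_box_of_isUnitarizable`).  This file is the TRANSPORT to the socket's own currency (`σ` on the block
`GL {i // lastBlockLabel 3 i = false} F`, labelling `Zelevinsky1980.lastBlockLabel 3`): (i) the statement is proved for a VARIABLE labelling `c` with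
`c = ![false,false,true]` substituted (`aux`), so that ★ `lastBlockLabel_three` instantiates it at `lastBlockLabel 3` with no relabelling of induced modules;
(ii) `σ = (σ ∘ reindexGL e) ∘ (reindexGL e)⁻¹` for the block equivalence `e` of ★ `exists_blockEquiv_twoOne`, and `σ ∘ reindexGL e` is irreducible (★
`isIrreducible_comp_iff_of_surjective`), smooth (★ `continuous_reindexGL`) and unitarizable (same Hermitian form).
[cite: Zelevinsky1980, Thm. 4.2 p. 184] [cite: BernsteinZelevinsky1977, Thm. 2.9, Thm. 4.2, §2.3] [cite: Rogawski1990, §13.3 p. 201]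

HONEST LABEL: organ; the tie of S1#7 (an ED. of `R90_S1_SplitLocalPacketsB.lean`) is the dealer's ∕ p01's act.  HC_CM is proved only modulo the 7 printed citations (2 remaining named
inputs: hLiu418 = stmt-HodgeConjecture-24832, h413 = stmt-HodgeConjecture-24833) until rung 0 closes.
-/

set_option autoImplicit false
-- the mandated namespace repeats `HodgeConjecture.HodgeConjecture`, as in every `Theorems/*.lean` of this sub-problem
set_option linter.dupNamespace false

noncomputable section

open Representation Function Literature.NumberTheory.Automorphic Literature.NumberTheory.Automorphic.Zelevinsky1980
open Literature.NumberTheory.GaloisRepresentations.IsNonarchimedeanLocalField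
open scoped MatrixGroups

namespace Summit.HodgeConjecture.HodgeConjecture.Cruxes.H413.R90S1SplitInducedIrreducibleOfUnitary

variable {F : Type} [Field F] [ValuativeRel F] [TopologicalSpace F] [IsNonarchimedeanLocalField F]

set_option maxHeartbeats 1600000 in  -- cumulative budget of the declaration over large induced-module terms
/-- **AUXILIARY (variable labelling `c = ![false,false,true]`)**: S1#7 for `σ` on the block `GL {i // c i = false} F`, from road α′'s ★ box theorem applied to `σ ∘ reindexGL e`.
[cite: Zelevinsky1980, Thm. 4.2 p. 184] [cite: BernsteinZelevinsky1977, Thm. 4.2, §2.3] -/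
theorem aux (c : Fin 3 → Bool) (hc : c = (![false, false, true] : Fin 3 → Bool)) [LocallyCompactSpace ↥(standardParabolicGL F c)]
    {W : Type} [AddCommGroup W] [Module ℂ W] (σ : Representation ℂ (GL {i : Fin 3 // c i = false} F) W)
    (hσi : σ.IsIrreducible) (hσs : σ.IsSmooth) (hσu : σ.IsUnitarizable)
    (χ' : Fˣ →* ℂˣ) (hχ'u : ∀ x, ‖((χ' x : ℂˣ) : ℂ)‖ = 1) (hχ'c : Continuous fun x => ((χ' x : ℂˣ) : ℂ)) :
    (Representation.parabolicIndGL F c (Representation.twist (σ.comp (Pi.evalMonoidHom (fun a : Bool => GL {i : Fin 3 // c i = a} F) false)) (χ'.comp (Matrix.GeneralLinearGroup.det.comp (Pi.evalMonoidHom (fun a : Bool => GL {i : Fin 3 // c i = a} F) true))))).IsIrreducible := by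
  subst hc
  haveI : IsTopologicalRing F := inferInstance
  obtain ⟨e, he⟩ := K2E3GL3ExponentRules.exists_blockEquiv_twoOne
  have hσ₂ : (σ.comp (reindexGL (k := F) e).toMonoidHom).comp (reindexGL (k := F) e).symm.toMonoidHom = σ := by
    refine MonoidHom.ext fun g => ?_
    simp only [MonoidHom.comp_apply, MulEquiv.coe_toMonoidHom, MulEquiv.apply_symm_apply]
  have hσ₂i : Representation.IsIrreducible (V := W) (σ.comp (reindexGL (k := F) e).toMonoidHom) :=
    (Representation.isIrreducible_comp_iff_of_surjective σ (reindexGL (k := F) e).toMonoidHom (reindexGL (k := F) e).surjective).2 hσi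
  have hσ₂s : Representation.IsSmooth (σ.comp (reindexGL (k := F) e).toMonoidHom) :=
    IsSmooth.comp_of_continuous σ (reindexGL (k := F) e).toMonoidHom (continuous_reindexGL e) hσs
  have hσ₂u : Representation.IsUnitarizable (σ.comp (reindexGL (k := F) e).toMonoidHom) := by
    obtain ⟨Bf, hBsymm, hBpos, hBinv⟩ := hσu
    exact ⟨Bf, hBsymm, hBpos, fun g v w => hBinv (reindexGL (k := F) e g) v w⟩
  have key := R90.S1.isIrreducible_parabolicIndGL_box_of_isUnitarizable e he (σ.comp (reindexGL (k := F) e).toMonoidHom) hσ₂i hσ₂s hσ₂u χ' hχ'u hχ'c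
  rw [hσ₂] at key
  exact key

/-- **SOCKET S1#7 AS TYPED** (`stub_S1_split_parabolicInd_irreducible_of_unitary`, `R90_S1_SplitLocalPacketsB.lean` :130–:143, binders VERBATIM): for `σ` irreducible smooth admissible
unitarizable on the `GL₂`-block of `lastBlockLabel 3` and `χ′` unitary continuous, `n-Ind_{P(2,1)}^{GL₃(F)}(σ ⊠ χ′)` is irreducible.  `aux` at `lastBlockLabel 3 = ![false,false,true]`
(★ `lastBlockLabel_three`). [cite: Zelevinsky1980, Thm. 4.2 p. 184] [cite: BernsteinZelevinsky1977, Thm. 2.9, Thm. 4.2, §2.3] [cite: Rogawski1990, §13.3 p. 201] -/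
theorem splitInducedIrreducible_of_unitary :
    ∀ (F : Type) [Field F] [ValuativeRel F] [TopologicalSpace F] [IsNonarchimedeanLocalField F]
      [LocallyCompactSpace ↥(standardParabolicGL F (Zelevinsky1980.lastBlockLabel 3))]
      (W : Type) [AddCommGroup W] [Module ℂ W]
      (σ : Representation ℂ (GL {i : Fin 3 // Zelevinsky1980.lastBlockLabel 3 i = false} F) W)
      (_hσi : σ.IsIrreducible) (_hσs : σ.IsSmooth) (_hσa : σ.IsAdmissible) (_hσu : σ.IsUnitarizable)
      (χ' : Fˣ →* ℂˣ) (_hχ'u : ∀ x, ‖((χ' x : ℂˣ) : ℂ)‖ = 1) (_hχ'c : Continuous fun x => ((χ' x : ℂˣ) : ℂ)),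
      (Representation.parabolicIndGL F (Zelevinsky1980.lastBlockLabel 3)
        (Representation.twist
          (σ.comp (Pi.evalMonoidHom (fun a : Bool => GL {i : Fin 3 // Zelevinsky1980.lastBlockLabel 3 i = a} F) false))
          (χ'.comp (Matrix.GeneralLinearGroup.det.comp
            (Pi.evalMonoidHom (fun a : Bool => GL {i : Fin 3 // Zelevinsky1980.lastBlockLabel 3 i = a} F) true))))).IsIrreducible :=
  fun _ _ _ _ _ _ _ _ _ σ hσi hσs _ hσu χ' hχ'u hχ'c =>
    aux (lastBlockLabel 3) K2E3GL3MaximalParabolicRelabel.lastBlockLabel_three σ hσi hσs hσu χ' hχ'u hχ'c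

end Summit.HodgeConjecture.HodgeConjecture.Cruxes.H413.R90S1SplitInducedIrreducibleOfUnitary

end
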